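import Summits.FinalStateConjecture.FinalStateConjecture.Theorems.EIHFluxBalanceInertialRecessionStubEndgameBasics

/-!
# Route EIHFluxBalance — crux `InertialRecession`, abstract endgame for general `N`:
# strong convexity of the relativistic energy and the internal-energy lower bound

Helper file for the crux `stmt-FinalStateConjecture-10166` (virial route, see the evidence note
`InertialRecession_endgame_generalN_virial.md`, §2). Two Mathlib-only bricks:

* `energy_strongConvexity` — for `E_M(p) = √(M² + ‖p‖²)`:
  `M²‖p − q‖²/(2 E_M(p) E_M(q)²) ≤ E_M(p) − E_M(q) − ⟨E_M(q)⁻¹ q, p − q⟩`.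
  Proof: `(E_pE_q)² ≥ (M² + ⟨p,q⟩)² + M²‖p − q‖²` (expand; Cauchy–Schwarz), and `X² ≥ A² + D ⇒ 2X(X − A) ≥ D`.
* `internalEnergy_ge` — for a finite family of rest masses `Mⱼ > 0` and momenta `pⱼ`, with `P = Σpⱼ`, `M_B = ΣMⱼ` and the COLD
  momenta `p̄ⱼ = (Mⱼ/M_B)P` (all members moving with the common velocity `P/√(M_B² + ‖P‖²)`), the internal energy
  `K = Σⱼ E_{Mⱼ}(pⱼ) − √(M_B² + ‖P‖²)` dominates `Σⱼ Mⱼ²‖pⱼ − p̄ⱼ‖²/(2E_{Mⱼ}(pⱼ)E_{Mⱼ}(p̄ⱼ)²)`; in particular `K ≥ 0` with equality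
  iff the group is cold. (Sum `energy_strongConvexity` at `q = p̄ⱼ`; the linear terms cancel because `p̄ⱼ/E(p̄ⱼ)` is the common
  cold velocity and `Σ(pⱼ − p̄ⱼ) = 0`; and `Σⱼ E_{Mⱼ}(p̄ⱼ) = √(M_B² + ‖P‖²)`.)
In the endgame `K_B` of a window-isolated group `B` is conserved (sharp ± 2ζ) — it is a 1-Lipschitz function of the cluster
4-momentum — so this lemma turns "small conserved internal energy" into "all member momenta near their cold values", i.e. coldness.
-/

noncomputable section

set_option linter.dupNamespace false

open Finset

namespace Summit.FinalStateConjecture.FinalStateConjecture.Theorems.SublinearIsFree.Virial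

open Literature.Geometry.Lorentzian

/-! ### Strong convexity of `p ↦ √(M² + ‖p‖²)` -/

/-- **Strong convexity of the relativistic energy.** With `E_M(p) = √(M² + ‖p‖²)`:
`M²‖p − q‖²/(2E_M(p)E_M(q)²) ≤ E_M(p) − E_M(q) − ⟨E_M(q)⁻¹q, p − q⟩` for every `M ≠ 0`. [folklore] -/
theorem energy_strongConvexity' {M : ℝ} (hM : M ≠ 0) (p q : E3) :
    M ^ 2 * ‖p - q‖ ^ 2 / (2 * √(M ^ 2 + ‖p‖ ^ 2) * (√(M ^ 2 + ‖q‖ ^ 2)) ^ 2) ≤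
      √(M ^ 2 + ‖p‖ ^ 2) - √(M ^ 2 + ‖q‖ ^ 2) - inner ℝ ((√(M ^ 2 + ‖q‖ ^ 2))⁻¹ • q) (p - q) := by
  set Ep : ℝ := √(M ^ 2 + ‖p‖ ^ 2) with hEp
  set Eq : ℝ := √(M ^ 2 + ‖q‖ ^ 2) with hEq
  have hM2 : 0 < M ^ 2 := by positivity
  have hp2 : 0 < M ^ 2 + ‖p‖ ^ 2 := by positivity
  have hq2 : 0 < M ^ 2 + ‖q‖ ^ 2 := by positivity
  have hEp0 : 0 < Ep := Real.sqrt_pos.mpr hp2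
  have hEq0 : 0 < Eq := Real.sqrt_pos.mpr hq2
  have hEp2 : Ep ^ 2 = M ^ 2 + ‖p‖ ^ 2 := Real.sq_sqrt hp2.le
  have hEq2 : Eq ^ 2 = M ^ 2 + ‖q‖ ^ 2 := Real.sq_sqrt hq2.le
  -- Cauchy–Schwarz and the polarisation of `‖p − q‖²`
  have hCS : (inner ℝ p q) ^ 2 ≤ ‖p‖ ^ 2 * ‖q‖ ^ 2 := by
    have h := abs_real_inner_le_norm p q
    have h0 : 0 ≤ ‖p‖ * ‖q‖ := by positivity
    calc (inner ℝ p q) ^ 2 = |inner ℝ p q| ^ 2 := (sq_abs _).symm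
      _ ≤ (‖p‖ * ‖q‖) ^ 2 := pow_le_pow_left₀ (abs_nonneg _) h 2
      _ = ‖p‖ ^ 2 * ‖q‖ ^ 2 := by ring
  have hpq : ‖p - q‖ ^ 2 = ‖p‖ ^ 2 - 2 * inner ℝ p q + ‖q‖ ^ 2 := norm_sub_sq_real p q
  -- the key algebraic inequality `(E_pE_q)² ≥ (M² + ⟨p,q⟩)² + M²‖p − q‖²`
  set X : ℝ := Ep * Eq with hX
  set A : ℝ := M ^ 2 + inner ℝ p q with hA
  have hX0 : 0 < X := mul_pos hEp0 hEq0
  have hX2 : X ^ 2 = (M ^ 2 + ‖p‖ ^ 2) * (M ^ 2 + ‖q‖ ^ 2) := by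
    rw [hX, mul_pow, hEp2, hEq2]
  have hkey : A ^ 2 + M ^ 2 * ‖p - q‖ ^ 2 ≤ X ^ 2 := by
    rw [hX2, hA, hpq]; nlinarith [hCS]
  have h2 : M ^ 2 * ‖p - q‖ ^ 2 ≤ 2 * X * (X - A) := by nlinarith [sq_nonneg (X - A)]
  -- the right-hand side equals `(X − A)/E_q`
  have hrhs : Ep - Eq - inner ℝ (Eq⁻¹ • q) (p - q) = (X - A) / Eq := by
    rw [real_inner_smul_left, inner_sub_right, real_inner_self_eq_norm_sq, real_inner_comm p q, hX, hA,
      eq_div_iff hEq0.ne']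
    have hinv : Eq⁻¹ * Eq = 1 := inv_mul_cancel₀ hEq0.ne'
    have hEqsq : Eq * Eq = M ^ 2 + ‖q‖ ^ 2 := by rw [← sq]; exact hEq2
    linear_combination (-(inner ℝ p q - ‖q‖ ^ 2)) * hinv - hEqsq
  rw [hrhs, div_le_div_iff₀ (by positivity) hEq0]
  calc M ^ 2 * ‖p - q‖ ^ 2 * Eq ≤ 2 * X * (X - A) * Eq :=
        mul_le_mul_of_nonneg_right h2 hEq0.le
    _ = (X - A) * (2 * Ep * Eq ^ 2) := by rw [hX]; ring

/-! ### The internal energy of a group dominates the squared distance to the cold momenta -/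

/-- Energy of a cold share: `√(Mⱼ² + ‖(Mⱼ/M_B)P‖²) = (Mⱼ/M_B)√(M_B² + ‖P‖²)` for `Mⱼ, M_B > 0`. [folklore] -/
theorem sqrt_sq_add_norm_coldShare {Mj MB : ℝ} (hMj : 0 < Mj) (hMB : 0 < MB) (P : E3) :
    √(Mj ^ 2 + ‖(Mj / MB) • P‖ ^ 2) = Mj / MB * √(MB ^ 2 + ‖P‖ ^ 2) := by
  have hr : 0 < Mj / MB := div_pos hMj hMB
  have h1 : Mj ^ 2 + ‖(Mj / MB) • P‖ ^ 2 = (Mj / MB) ^ 2 * (MB ^ 2 + ‖P‖ ^ 2) := by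
    rw [norm_smul, Real.norm_eq_abs, abs_of_pos hr, mul_pow]
    field_simp
  rw [h1, Real.sqrt_mul (sq_nonneg _), Real.sqrt_sq hr.le]

/-- **Internal energy lower bound.** For rest masses `Mⱼ > 0` (`j ∈ s`, `s` nonempty) and momenta `pⱼ`, with `P = Σpⱼ`,
`M_B = ΣMⱼ`, cold momenta `p̄ⱼ = (Mⱼ/M_B)P`:
`Σⱼ Mⱼ²‖pⱼ − p̄ⱼ‖²/(2E_{Mⱼ}(pⱼ)E_{Mⱼ}(p̄ⱼ)²) ≤ Σⱼ √(Mⱼ² + ‖pⱼ‖²) − √(M_B² + ‖P‖²)`. [folklore] -/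
theorem internalEnergy_ge' {ι : Type*} (s : Finset ι) (M : ι → ℝ) (p : ι → E3)
    (hM : ∀ i ∈ s, 0 < M i) (hs : s.Nonempty) :
    ∑ j ∈ s, (M j) ^ 2 * ‖p j - (M j / ∑ i ∈ s, M i) • ∑ i ∈ s, p i‖ ^ 2 /
        (2 * √((M j) ^ 2 + ‖p j‖ ^ 2) * (√((M j) ^ 2 + ‖(M j / ∑ i ∈ s, M i) • ∑ i ∈ s, p i‖ ^ 2)) ^ 2) ≤
      ∑ j ∈ s, √((M j) ^ 2 + ‖p j‖ ^ 2) - √((∑ i ∈ s, M i) ^ 2 + ‖∑ i ∈ s, p i‖ ^ 2) := by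
  classical
  set MB : ℝ := ∑ i ∈ s, M i with hMB
  set P : E3 := ∑ i ∈ s, p i with hP
  have hMB0 : 0 < MB := Finset.sum_pos hM hs
  set pbar : ι → E3 := fun j ↦ (M j / MB) • P with hpbar
  -- per-member strong convexity at `q = p̄ⱼ`
  have hconv : ∀ j ∈ s, (M j) ^ 2 * ‖p j - pbar j‖ ^ 2 /
      (2 * √((M j) ^ 2 + ‖p j‖ ^ 2) * (√((M j) ^ 2 + ‖pbar j‖ ^ 2)) ^ 2) ≤
      √((M j) ^ 2 + ‖p j‖ ^ 2) - √((M j) ^ 2 + ‖pbar j‖ ^ 2) -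
        inner ℝ ((√((M j) ^ 2 + ‖pbar j‖ ^ 2))⁻¹ • pbar j) (p j - pbar j) := fun j hj ↦
    energy_strongConvexity' (hM j hj).ne' (p j) (pbar j)
  -- the cold velocity is common: `E(p̄ⱼ)⁻¹ p̄ⱼ = P/√(M_B² + ‖P‖²)`
  have hcold : ∀ j ∈ s, (√((M j) ^ 2 + ‖pbar j‖ ^ 2))⁻¹ • pbar j = (√(MB ^ 2 + ‖P‖ ^ 2))⁻¹ • P := by
    intro j hj
    have hMj := hM j hj
    have hE : √((M j) ^ 2 + ‖pbar j‖ ^ 2) = M j / MB * √(MB ^ 2 + ‖P‖ ^ 2) :=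
      sqrt_sq_add_norm_coldShare hMj hMB0 P
    have hS0 : 0 < √(MB ^ 2 + ‖P‖ ^ 2) := Real.sqrt_pos.mpr (by positivity)
    have hr : 0 < M j / MB := div_pos hMj hMB0
    rw [hE, hpbar]
    simp only
    rw [smul_smul, mul_inv, mul_assoc, mul_comm ((√(MB ^ 2 + ‖P‖ ^ 2))⁻¹) (M j / MB), ← mul_assoc,
      inv_mul_cancel₀ hr.ne', one_mul]
  -- the energies of the cold shares sum to the cold energy
  have hEsum : ∑ j ∈ s, √((M j) ^ 2 + ‖pbar j‖ ^ 2) = √(MB ^ 2 + ‖P‖ ^ 2) := by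
    have : ∀ j ∈ s, √((M j) ^ 2 + ‖pbar j‖ ^ 2) = M j / MB * √(MB ^ 2 + ‖P‖ ^ 2) := fun j hj ↦
      sqrt_sq_add_norm_coldShare (hM j hj) hMB0 P
    rw [Finset.sum_congr rfl this, ← Finset.sum_mul, ← Finset.sum_div, ← hMB, div_self hMB0.ne', one_mul]
  -- the linear terms cancel: `Σ(pⱼ − p̄ⱼ) = 0`
  have hlin : ∑ j ∈ s, inner ℝ ((√((M j) ^ 2 + ‖pbar j‖ ^ 2))⁻¹ • pbar j) (p j - pbar j) = 0 := by
    rw [Finset.sum_congr rfl fun j hj ↦ by rw [hcold j hj], ← inner_sum, Finset.sum_sub_distrib]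
    have hpb : ∑ j ∈ s, pbar j = P := by
      simp only [hpbar]
      rw [← Finset.sum_smul, ← Finset.sum_div, ← hMB, div_self hMB0.ne', one_smul]
    rw [hpb, ← hP, sub_self, inner_zero_right]
  calc ∑ j ∈ s, (M j) ^ 2 * ‖p j - pbar j‖ ^ 2 /
          (2 * √((M j) ^ 2 + ‖p j‖ ^ 2) * (√((M j) ^ 2 + ‖pbar j‖ ^ 2)) ^ 2)
        ≤ ∑ j ∈ s, (√((M j) ^ 2 + ‖p j‖ ^ 2) - √((M j) ^ 2 + ‖pbar j‖ ^ 2) -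
            inner ℝ ((√((M j) ^ 2 + ‖pbar j‖ ^ 2))⁻¹ • pbar j) (p j - pbar j)) := Finset.sum_le_sum hconv
    _ = ∑ j ∈ s, √((M j) ^ 2 + ‖p j‖ ^ 2) - √(MB ^ 2 + ‖P‖ ^ 2) := by
          rw [Finset.sum_sub_distrib, Finset.sum_sub_distrib, hlin, hEsum, sub_zero]

/-! ### Registered stubs (one-line signatures, verbatim) -/

/-- Registered stub `energy_strongConvexity` (crux `stmt-FinalStateConjecture-10166`): strong convexity of the relativistic
energy, one-line form of `energy_strongConvexity'`. [folklore] -/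
theorem energy_strongConvexity : open Literature.Geometry.Lorentzian in ∀ {M : ℝ}, M ≠ 0 → ∀ (p q : E3), M ^ 2 * ‖p - q‖ ^ 2 / (2 * √(M ^ 2 + ‖p‖ ^ 2) * (√(M ^ 2 + ‖q‖ ^ 2)) ^ 2) ≤ √(M ^ 2 + ‖p‖ ^ 2) - √(M ^ 2 + ‖q‖ ^ 2) - inner ℝ ((√(M ^ 2 + ‖q‖ ^ 2))⁻¹ • q) (p - q) :=
  fun hM p q ↦ energy_strongConvexity' hM p q

/-- Registered stub `internalEnergy_ge` (crux `stmt-FinalStateConjecture-10166`): the internal energy of a group dominates the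
squared distance of the member momenta to their cold values, one-line form of `internalEnergy_ge'`. [folklore] -/
theorem internalEnergy_ge : open Literature.Geometry.Lorentzian in ∀ {ι : Type*} (s : Finset ι) (M : ι → ℝ) (p : ι → E3), (∀ i ∈ s, 0 < M i) → s.Nonempty → ∑ j ∈ s, (M j) ^ 2 * ‖p j - (M j / ∑ i ∈ s, M i) • ∑ i ∈ s, p i‖ ^ 2 / (2 * √((M j) ^ 2 + ‖p j‖ ^ 2) * (√((M j) ^ 2 + ‖(M j / ∑ i ∈ s, M i) • ∑ i ∈ s, p i‖ ^ 2)) ^ 2) ≤ ∑ j ∈ s, √((M j) ^ 2 + ‖p j‖ ^ 2) - √((∑ i ∈ s, M i) ^ 2 + ‖∑ i ∈ s, p i‖ ^ 2) :=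
  fun s M p hM hs ↦ internalEnergy_ge' s M p hM hs

end Summit.FinalStateConjecture.FinalStateConjecture.Theorems.SublinearIsFree.Virial

end
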